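/-
Copyright (c) 2026 the pub-hodgecm-mathlib formalisation cell (harness21).  Prover seat hodgecm-mathlib-LH4-p01 (g17): STAGE 1a «(D-RAM) FOUR-FRAME» crux H413 (director s1808;
heir LEAD F0P3a-plan (g18) T17-31 (R-9); dealer LH4-plan (g10) WORD #15; U0 assembler = this seat) — TIER 2 for the registered stub `stub_U0_iwahoriIndex_wild` of the tier-1
module `Cruxes/H413/Lines/F0_P3c_DyRamFourFrame_U0_WildTree.lean`.  ADAPTED from ★ `UnitaryLatticeTreeLevelIndices` §3 (ThreeRamified; LH10-p02 (g12)) with the tame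
trace-element inputs replaced by the WILD root-star ∕ self-dual transitivity (★ p854659, ★ p854568 — this seat) and the wild star counts (★ p854714, ★ p854683 — LH4-p02 (g12)).
2026-09-03.
-/
import Literature.NumberTheory.Automorphic.UnitaryLatticeTreeLevelIndices              -- ★ §0 `subgroupOf_glInt_eq_unitaryInt`, §1 `relIndex_conj_glInt_eq_ncard_orbit`, `relIndex_glInt_eq_ncard_orbit` (orbit–stabiliser, any datum)
import Literature.NumberTheory.Automorphic.UnitaryLatticeTreeRootStarCountWild        -- ★ p854714 (LH4-p02): `mem_neighborSet_root_iff_exists_mem_unitaryInt_of_even`, `ncard_neighborSet_root_wild`; brings ★ p854659, ★ p854683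
import Literature.NumberTheory.Automorphic.UnitaryLatticeTreeSelfDualTransitiveWild    -- ★ p854568 (this seat): htr₀-WILD `exists_unitary_mapGL_stdLattice_eq_of_isSelfDualLattice_of_ramified`, `v_map_sub_self_lt_one_of_even`
import HarnessLib

/-!
# THE IWAHORI INDICES `[K₀ : K₀ ⊓ K₁] = q + 1 = [K₁ : K₀ ⊓ K₁]` OF THE RAMIFIED QUASI-SPLIT `U(3)` AT EVERY RAMIFIED QUADRATIC DATUM, WILD (DYADIC) PLACES INCLUDED
# (Bruhat–Tits 1972 §10; Tits 1979 §2.4, §2.7, §3.5; Serre, *Trees*, II.1.1; Kottwitz 1988 §2)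

THEOREMS ONLY (no definition ∕ instance ∕ notation ∕ named fact ∕ `sorry`).  Topic `NumberTheory/Automorphic`; namespace `Literature.NumberTheory.Automorphic.UnitaryLatticeTree`.
Cell `pub/hodgecm-mathlib`, crux H413 = `stmt-HodgeConjecture-24833` (`--supports` lane, helper; count-neutral).  The levels are spelled EXACTLY as in ★ `UnitaryLatticeTreeLevelIndices`
(and as in U0's stub): `K₀ = (glInt 3 K).subgroupOf U`, `K₁ = ((glInt 3 K).map (MulAut.conj g₁).toMonoidHom).subgroupOf U`, `U = unitaryGroupOfForm σ Φ₃`, `Φ₃ = antidiag(1,1,1)`,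
`g₁ = diag(1, 1, ϖ)` (so `K₁ = Stab_U(N₁)`, `N₁ = g₁·𝒪³ = latt diag(1,1,ϖ)`).

THE WILD RE-LETTERING.  ★ `…LevelIndices` §3 proves the two indices at a TAME ramified datum (`σϖ = −ϖ`, `|2| = 1`, trace element `t + σt = 1`, `hnorm`).  Here the datum is ANY
ramified quadratic datum in the sense of the (D-RAM) line — `σ` an isometric involution, `|ϖ| = exp(−1)`, `σ`-fixed non-zero elements of EVEN valuation, `|ϖ − σϖ| = |ϖ|^d` with
`d ≥ 1`, `|2| = |ϖ|^t` — and the four tame inputs are replaced one for one: (i) the `K₀`-orbit of `N₁` is the star of the root by ★ p854714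
`mem_neighborSet_root_iff_exists_mem_unitaryInt_of_even` (over ★ p854659's wild root-star transitivity); (ii) the `K₁`-orbit of the root is the star of `N₁` by ★ p854568's wild
self-dual transitivity + ★ p854659 `exists_mem_unitaryInt_eq_mapGL_N₁_of_lt_of_ramified`; (iii) `#star(𝒪³) = q + 1` by ★ p854714 `ncard_neighborSet_root_wild` (at `|2| < 1` the
residual conic is the double line `x₁² = 0`); (iv) `#star(N₁) = q + 1` by ★ p854683 `ncard_neighborSet_of_isVertexLattice_two_wild`.  The orbit–stabiliser identities
`K₁.relIndex K₀ = #(K₀·N₁)`, `K₀.relIndex K₁ = #(K₁·𝒪³)` are ★ §1 of `…LevelIndices` verbatim (datum-free).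

* §1 `setOf_orbit_conj_eq_image_neighborSet_root_of_ramified_wild`, `setOf_orbit_root_eq_image_neighborSet_N₁_of_ramified_wild` — orbit = star, both sides.
* §2 `relIndex_conj_glInt_eq_of_ramified_wild` (`[K₀ : K₀ ⊓ K₁] = q + 1`), `relIndex_glInt_eq_of_ramified_wild` (`[K₁ : K₀ ⊓ K₁] = q + 1`), `index_inf_subgroupOf_eq_of_ramified_wild`
  (both, in the `(K₀ ⊓ K₁).subgroupOf Kᵢ` spelling — the conclusion of ★ `index_inf_subgroupOf_eq_of_ramified` TOKEN FOR TOKEN).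
* §3 DATUM HEAD `index_inf_subgroupOf_eq_of_isRamifiedQuadraticDatum` — the text of U0's `stub_U0_iwahoriIndex_wild` after its binder prefix (the module pays the stub by `exact`;
  its extra `[CompleteSpace K] [Fintype 𝓀[K]]` are idle here: `[Finite 𝓀[K]]` suffices).

HONEST LABEL: count-neutral helper (closes no node; pays one registered U0 stub of the (D-RAM) FOUR-FRAME line); h413 OPEN; HC_CM is proved only modulo the 7 printed citations
(2 remaining named inputs hLiu418 = stmt-HodgeConjecture-24832, h413 = stmt-HodgeConjecture-24833) until rung 0 closes.  Nothing printed is asserted: subgroup indices of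
explicit stabilisers in an explicit lattice tree.

## References
* [BruhatTits1972] F. Bruhat, J. Tits, *Groupes réductifs sur un corps local I*, Publ. Math. IHÉS 41 (1972), §10, (4.4.4).
* [Tits1979] J. Tits, *Reductive groups over local fields*, PSPM 33.1 (1979), §2.4, §2.7 (local index `(q+1, q+1)` of the ramified quasi-split `U(3)`: both vertices special), §3.5.
* [Serre1980Trees] J.-P. Serre, *Trees* (1980), Ch. II §1.1 (stabilisers, orbit–stabiliser counts of stars).
* [Kottwitz1988] R. E. Kottwitz, *Tamagawa numbers*, Ann. of Math. 127 (1988), §2 (the levels `K₀`, `K₁`, `I` of a rank-one group).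
-/

set_option autoImplicit false

noncomputable section

open Matrix Literature.NumberTheory.Automorphic Literature.Combinatorics.SimpleGraph
open Literature.NumberTheory.Automorphic.HermitianLattice Literature.NumberTheory.Automorphic.UnitaryGroup Literature.NumberTheory.Automorphic.CartanUnique
open Literature.NumberTheory.Automorphic.UnitaryThreeFourFrame
open scoped Matrix MatrixGroups WithZero Valued

namespace Literature.NumberTheory.Automorphic.UnitaryLatticeTree

variable {K : Type*} [Field K] [Valued K ℤᵐ⁰] [ValuativeRel K] [(Valued.v : Valuation K ℤᵐ⁰).Compatible] {σ : K →+* K} {ϖ : K}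

/-! ## §1 Orbit = star on both sides, at a wild ramified datum -/

/-- **The `K₀`-orbit of `N₁ = g₁·L₀` is the star of the root — wild edition** (★ p854714 `mem_neighborSet_root_iff_exists_mem_unitaryInt_of_even` read through ★ §0
`subgroupOf_glInt_eq_unitaryInt`). [cite: BruhatTits1972, (4.4.4) and §10] [cite: Serre1980Trees, Ch. II §1.1] -/
theorem setOf_orbit_conj_eq_image_neighborSet_root_of_ramified_wild [Finite 𝓀[K]] (hσ : ∀ x, σ (σ x) = x) (hvσ : ∀ a, Valued.v (σ a) = Valued.v a)
    (hϖ : Valued.v ϖ = WithZero.exp (-1 : ℤ)) (heven : ∀ x : K, σ x = x → x ≠ 0 → ∃ n : ℤ, Valued.v x = WithZero.exp (2 * n)) {d t : ℕ}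
    (hd : Valued.v (ϖ - σ ϖ) = Valued.v ϖ ^ d) (h1d : 1 ≤ d) (h2t : Valued.v (2 : K) = Valued.v ϖ ^ t)
    (g₁ : GL (Fin 3) K) (hg₁ : (g₁ : Matrix (Fin 3) (Fin 3) K) = Matrix.diagonal ![(1 : K), 1, ϖ]) :
    {M : Submodule (Valued.integer K) (Fin 3 → K) | ∃ k : ↥(unitaryGroupOfForm σ ((StdForm.antidiagonal 3).over K)),
        k ∈ (glInt 3 K).subgroupOf (unitaryGroupOfForm σ ((StdForm.antidiagonal 3).over K)) ∧ mapGL ((k : GL (Fin 3) K) * g₁) (stdLattice K 3) = M} =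
      Subtype.val '' ((latticeGraph σ ϖ ((StdForm.antidiagonal 3).over K)).neighborSet ⟨stdLattice K 3, 0, isSelfDualLattice_stdLattice_three_of_v hϖ⟩) := by
  have hN₁ : mapGL g₁ (stdLattice K 3) = latt (Matrix.diagonal ![(1 : K), 1, ϖ]) := by rw [← hg₁]; rfl
  have h2v : IsVertexLattice σ ϖ ((StdForm.antidiagonal 3).over K) 2 (latt (Matrix.diagonal ![(1 : K), 1, ϖ])) := isVertexLattice_two_N₁_of_uniformizer hvσ hϖ
  ext M
  constructor
  · rintro ⟨k, hk, rfl⟩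
    have hk' : k ∈ unitaryInt σ ((StdForm.antidiagonal 3).over K) := by rwa [← subgroupOf_glInt_eq_unitaryInt]
    refine ⟨⟨mapGL (k : GL (Fin 3) K) (latt (Matrix.diagonal ![(1 : K), 1, ϖ])), 2, isVertexLattice_mapGL σ ϖ _ _ k.2 h2v⟩,
      (mem_neighborSet_root_iff_exists_mem_unitaryInt_of_even hσ hvσ hϖ heven hd h1d h2t _).2 ⟨k, hk', rfl⟩, ?_⟩
    rw [mapGL_mul, hN₁]
  · rintro ⟨w, hw, rfl⟩
    obtain ⟨κ, hκ, hwκ⟩ := (mem_neighborSet_root_iff_exists_mem_unitaryInt_of_even hσ hvσ hϖ heven hd h1d h2t w).1 hw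
    refine ⟨κ, by rwa [subgroupOf_glInt_eq_unitaryInt], ?_⟩
    rw [mapGL_mul, hN₁, hwκ]

/-- **The `K₁`-orbit of the root `L₀` is the star of `N₁` — wild edition**: a self-dual neighbour `M` of `N₁` is `u·L₀` (★ p854568 wild self-dual transitivity), `u⁻¹·N₁` is a
type-two vertex below the root, i.e. `κ·N₁` with `κ ∈ K₀` (★ p854659 wild exhaustion), and `u κ ∈ K₁` carries `L₀` to `M`. [cite: BruhatTits1972, §10] [cite: Serre1980Trees, Ch. II §1.1]
[cite: Tits1979, §3.5] -/
theorem setOf_orbit_root_eq_image_neighborSet_N₁_of_ramified_wild [Finite 𝓀[K]] (hσ : ∀ x, σ (σ x) = x) (hvσ : ∀ a, Valued.v (σ a) = Valued.v a)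
    (hϖ : Valued.v ϖ = WithZero.exp (-1 : ℤ)) (heven : ∀ x : K, σ x = x → x ≠ 0 → ∃ n : ℤ, Valued.v x = WithZero.exp (2 * n)) {d t : ℕ}
    (hd : Valued.v (ϖ - σ ϖ) = Valued.v ϖ ^ d) (h1d : 1 ≤ d) (h2t : Valued.v (2 : K) = Valued.v ϖ ^ t)
    (g₁ : GL (Fin 3) K) (hg₁ : (g₁ : Matrix (Fin 3) (Fin 3) K) = Matrix.diagonal ![(1 : K), 1, ϖ]) :
    {M : Submodule (Valued.integer K) (Fin 3 → K) | ∃ k : ↥(unitaryGroupOfForm σ ((StdForm.antidiagonal 3).over K)),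
        k ∈ ((glInt 3 K).map (MulAut.conj g₁).toMonoidHom).subgroupOf (unitaryGroupOfForm σ ((StdForm.antidiagonal 3).over K)) ∧ mapGL (k : GL (Fin 3) K) (stdLattice K 3) = M} =
      Subtype.val '' ((latticeGraph σ ϖ ((StdForm.antidiagonal 3).over K)).neighborSet
        ⟨latt (Matrix.diagonal ![(1 : K), 1, ϖ]), 2, isVertexLattice_two_N₁_of_uniformizer hvσ hϖ⟩) := by
  have hN₁ : mapGL g₁ (stdLattice K 3) = latt (Matrix.diagonal ![(1 : K), 1, ϖ]) := by rw [← hg₁]; rfl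
  have h2v : IsVertexLattice σ ϖ ((StdForm.antidiagonal 3).over K) 2 (latt (Matrix.diagonal ![(1 : K), 1, ϖ])) := isVertexLattice_two_N₁_of_uniformizer hvσ hϖ
  have hroot : IsSelfDualLattice σ ϖ ((StdForm.antidiagonal 3).over K) (stdLattice K 3) := isSelfDualLattice_stdLattice_three_of_v hϖ
  have hlt₁ : latt (Matrix.diagonal ![(1 : K), 1, ϖ]) < stdLattice K 3 := by
    have h := mapGL_N₁_lt_stdLattice_of_v hvσ hϖ h2v (Subgroup.one_mem (unitaryInt σ ((StdForm.antidiagonal 3).over K)))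
    rwa [Subgroup.coe_one, mapGL_one] at h
  -- membership in `K₁ = Stab(N₁)`
  have hK₁ : ∀ k : ↥(unitaryGroupOfForm σ ((StdForm.antidiagonal 3).over K)),
      k ∈ ((glInt 3 K).map (MulAut.conj g₁).toMonoidHom).subgroupOf (unitaryGroupOfForm σ ((StdForm.antidiagonal 3).over K)) ↔
        mapGL (k : GL (Fin 3) K) (latt (Matrix.diagonal ![(1 : K), 1, ϖ])) = latt (Matrix.diagonal ![(1 : K), 1, ϖ]) := by
    intro k
    rw [Subgroup.mem_subgroupOf, Subgroup.mem_map_equiv, MulAut.conj_symm_apply, ← mapGL_stdLattice_eq_iff_mem_glInt, ← hN₁,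
      ← (mapGL_injective g₁).eq_iff, ← mapGL_mul, show g₁ * (g₁⁻¹ * (k : GL (Fin 3) K) * g₁) = (k : GL (Fin 3) K) * g₁ by group, mapGL_mul]
  ext M
  constructor
  · rintro ⟨k, hk, rfl⟩
    have hfix := (hK₁ k).1 hk
    refine ⟨⟨mapGL (k : GL (Fin 3) K) (stdLattice K 3), 0, isVertexLattice_mapGL σ ϖ _ _ k.2 hroot⟩, ?_, rfl⟩
    rw [mem_neighborSet_N₁_iff_of_v hvσ hϖ h2v]
    calc latt (Matrix.diagonal ![(1 : K), 1, ϖ]) = mapGL (k : GL (Fin 3) K) (latt (Matrix.diagonal ![(1 : K), 1, ϖ])) := hfix.symm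
      _ < mapGL (k : GL (Fin 3) K) (stdLattice K 3) := (mapGL_lt_mapGL_iff (k : GL (Fin 3) K) _ _).2 hlt₁
  · rintro ⟨w, hw, rfl⟩
    have hlt : latt (Matrix.diagonal ![(1 : K), 1, ϖ]) < w.1 := (mem_neighborSet_N₁_iff_of_v hvσ hϖ h2v w).1 hw
    have hwsd : IsSelfDualLattice σ ϖ ((StdForm.antidiagonal 3).over K) w.1 := (isVertexLattice_two_and_isSelfDualLattice_of_lt_of_v hvσ hϖ ⟨2, h2v⟩ w.2 hlt).2
    obtain ⟨u, hu⟩ := exists_unitary_mapGL_stdLattice_eq_of_isSelfDualLattice_of_ramified hσ hvσ hϖ heven hd h1d h2t w.1 hwsd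
    -- `u⁻¹·N₁ < L₀` is a type-two vertex below the root, hence `κ·N₁` with `κ ∈ K₀`
    have h2' : IsVertexLattice σ ϖ ((StdForm.antidiagonal 3).over K) 2
        (mapGL ((u⁻¹ : ↥(unitaryGroupOfForm σ ((StdForm.antidiagonal 3).over K))) : GL (Fin 3) K) (latt (Matrix.diagonal ![(1 : K), 1, ϖ]))) :=
      isVertexLattice_mapGL σ ϖ _ _ (u⁻¹).2 h2v
    have hlt' : mapGL ((u⁻¹ : ↥(unitaryGroupOfForm σ ((StdForm.antidiagonal 3).over K))) : GL (Fin 3) K) (latt (Matrix.diagonal ![(1 : K), 1, ϖ])) <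
        stdLattice K 3 := by
      have h := (mapGL_lt_mapGL_iff ((u⁻¹ : ↥(unitaryGroupOfForm σ ((StdForm.antidiagonal 3).over K))) : GL (Fin 3) K) _ _).2 hlt
      rwa [hu, ← mapGL_mul, Subgroup.coe_inv, inv_mul_cancel, mapGL_one] at h
    obtain ⟨κ, hκ, hκeq⟩ := exists_mem_unitaryInt_eq_mapGL_N₁_of_lt_of_ramified hσ hvσ hϖ heven hd h1d h2t h2' hlt'
    refine ⟨u * κ, (hK₁ (u * κ)).2 ?_, ?_⟩
    · rw [Subgroup.coe_mul, mapGL_mul, ← hκeq, ← mapGL_mul, Subgroup.coe_inv, mul_inv_cancel, mapGL_one]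
    · rw [Subgroup.coe_mul, mapGL_mul, mapGL_stdLattice_of_mem_unitaryInt hκ, hu]

/-! ## §2 The two indices at a wild ramified datum -/

/-- **`[K₀ : K₀ ⊓ K₁] = q + 1` for the ramified `U(3)` at ANY ramified datum**: `K₁.relIndex K₀ = Nat.card 𝓀[K] + 1` (★ §1 orbit–stabiliser + §1 here + the star of the root ★ p854714
`ncard_neighborSet_root_wild`; `q = |𝓀[K]|`). [cite: Tits1979, §2.4, §2.7] [cite: BruhatTits1972, §10] [cite: Serre1980Trees, Ch. II §1.1] -/
theorem relIndex_conj_glInt_eq_of_ramified_wild [Finite 𝓀[K]] (hσ : ∀ x, σ (σ x) = x) (hvσ : ∀ a, Valued.v (σ a) = Valued.v a)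
    (hϖ : Valued.v ϖ = WithZero.exp (-1 : ℤ)) (heven : ∀ x : K, σ x = x → x ≠ 0 → ∃ n : ℤ, Valued.v x = WithZero.exp (2 * n)) {d t : ℕ}
    (hd : Valued.v (ϖ - σ ϖ) = Valued.v ϖ ^ d) (h1d : 1 ≤ d) (h2t : Valued.v (2 : K) = Valued.v ϖ ^ t)
    (g₁ : GL (Fin 3) K) (hg₁ : (g₁ : Matrix (Fin 3) (Fin 3) K) = Matrix.diagonal ![(1 : K), 1, ϖ]) :
    (((glInt 3 K).map (MulAut.conj g₁).toMonoidHom).subgroupOf (unitaryGroupOfForm σ ((StdForm.antidiagonal 3).over K))).relIndex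
        ((glInt 3 K).subgroupOf (unitaryGroupOfForm σ ((StdForm.antidiagonal 3).over K))) = Nat.card 𝓀[K] + 1 := by
  rw [relIndex_conj_glInt_eq_ncard_orbit, setOf_orbit_conj_eq_image_neighborSet_root_of_ramified_wild hσ hvσ hϖ heven hd h1d h2t g₁ hg₁,
    Set.ncard_image_of_injective _ Subtype.val_injective, ncard_neighborSet_root_wild hσ hvσ hϖ heven hd h1d h2t]

/-- **`[K₁ : K₀ ⊓ K₁] = q + 1` for the ramified `U(3)` at ANY ramified datum**: `K₀.relIndex K₁ = Nat.card 𝓀[K] + 1` (★ §1 orbit–stabiliser + §1 here + the star of `N₁` ★ p854683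
`ncard_neighborSet_of_isVertexLattice_two_wild`, the residual projective line; `σ̄ = id` on `𝓀` by ★ `v_map_sub_self_lt_one_of_even`). [cite: Tits1979, §2.4, §2.7] [cite: BruhatTits1972, §10]
[cite: Serre1980Trees, Ch. II §1.1] -/
theorem relIndex_glInt_eq_of_ramified_wild [Finite 𝓀[K]] (hσ : ∀ x, σ (σ x) = x) (hvσ : ∀ a, Valued.v (σ a) = Valued.v a)
    (hϖ : Valued.v ϖ = WithZero.exp (-1 : ℤ)) (heven : ∀ x : K, σ x = x → x ≠ 0 → ∃ n : ℤ, Valued.v x = WithZero.exp (2 * n)) {d t : ℕ}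
    (hd : Valued.v (ϖ - σ ϖ) = Valued.v ϖ ^ d) (h1d : 1 ≤ d) (h2t : Valued.v (2 : K) = Valued.v ϖ ^ t)
    (g₁ : GL (Fin 3) K) (hg₁ : (g₁ : Matrix (Fin 3) (Fin 3) K) = Matrix.diagonal ![(1 : K), 1, ϖ]) :
    ((glInt 3 K).subgroupOf (unitaryGroupOfForm σ ((StdForm.antidiagonal 3).over K))).relIndex
        (((glInt 3 K).map (MulAut.conj g₁).toMonoidHom).subgroupOf (unitaryGroupOfForm σ ((StdForm.antidiagonal 3).over K))) = Nat.card 𝓀[K] + 1 := by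
  have hres : ∀ x : K, Valued.v x ≤ 1 → Valued.v (σ x - x) < 1 := fun x hx => v_map_sub_self_lt_one_of_even hσ hϖ heven hd h1d hx
  have h20 : (2 : K) ≠ 0 := fun h2 => by
    rw [h2, map_zero] at h2t
    exact pow_ne_zero _ ((Valuation.ne_zero_iff _).2 (uniformizer_ne_zero hϖ)) h2t.symm
  rw [relIndex_glInt_eq_ncard_orbit, setOf_orbit_root_eq_image_neighborSet_N₁_of_ramified_wild hσ hvσ hϖ heven hd h1d h2t g₁ hg₁,
    Set.ncard_image_of_injective _ Subtype.val_injective,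
    ncard_neighborSet_of_isVertexLattice_two_wild hσ hvσ hϖ hres heven h20 _ (isVertexLattice_two_N₁_of_uniformizer hvσ hϖ)]

/-- **The two indices in the `K₀ ⊓ K₁` spelling, at ANY ramified datum**: `((K₀ ⊓ K₁).subgroupOf K₀).index = q + 1` and `((K₀ ⊓ K₁).subgroupOf K₁).index = q + 1`,
`q = Nat.card 𝓀[K]` — the local index `(q+1, q+1)` of the ramified quasi-split `U(3)` (both vertices special), wild places included; the conclusion of ★
`index_inf_subgroupOf_eq_of_ramified` TOKEN FOR TOKEN. [cite: Tits1979, §2.4, §2.7] [cite: Kottwitz1988, §2] -/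
theorem index_inf_subgroupOf_eq_of_ramified_wild [Finite 𝓀[K]] (hσ : ∀ x, σ (σ x) = x) (hvσ : ∀ a, Valued.v (σ a) = Valued.v a)
    (hϖ : Valued.v ϖ = WithZero.exp (-1 : ℤ)) (heven : ∀ x : K, σ x = x → x ≠ 0 → ∃ n : ℤ, Valued.v x = WithZero.exp (2 * n)) {d t : ℕ}
    (hd : Valued.v (ϖ - σ ϖ) = Valued.v ϖ ^ d) (h1d : 1 ≤ d) (h2t : Valued.v (2 : K) = Valued.v ϖ ^ t)
    (g₁ : GL (Fin 3) K) (hg₁ : (g₁ : Matrix (Fin 3) (Fin 3) K) = Matrix.diagonal ![(1 : K), 1, ϖ]) :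
    (((glInt 3 K).subgroupOf (unitaryGroupOfForm σ ((StdForm.antidiagonal 3).over K)) ⊓
        ((glInt 3 K).map (MulAut.conj g₁).toMonoidHom).subgroupOf (unitaryGroupOfForm σ ((StdForm.antidiagonal 3).over K))).subgroupOf
          ((glInt 3 K).subgroupOf (unitaryGroupOfForm σ ((StdForm.antidiagonal 3).over K)))).index = Nat.card 𝓀[K] + 1 ∧
      (((glInt 3 K).subgroupOf (unitaryGroupOfForm σ ((StdForm.antidiagonal 3).over K)) ⊓
        ((glInt 3 K).map (MulAut.conj g₁).toMonoidHom).subgroupOf (unitaryGroupOfForm σ ((StdForm.antidiagonal 3).over K))).subgroupOf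
          (((glInt 3 K).map (MulAut.conj g₁).toMonoidHom).subgroupOf (unitaryGroupOfForm σ ((StdForm.antidiagonal 3).over K)))).index = Nat.card 𝓀[K] + 1 := by
  constructor
  · rw [← Subgroup.relIndex, Subgroup.inf_relIndex_left]
    exact relIndex_conj_glInt_eq_of_ramified_wild hσ hvσ hϖ heven hd h1d h2t g₁ hg₁
  · rw [← Subgroup.relIndex, Subgroup.inf_relIndex_right]
    exact relIndex_glInt_eq_of_ramified_wild hσ hvσ hϖ heven hd h1d h2t g₁ hg₁

/-! ## §3 Datum head (the shape of U0's `stub_U0_iwahoriIndex_wild`) -/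

/-- **THE DATUM-FORM HEAD**: for every `IsRamifiedQuadraticDatum σ ϖ d t` with finite residue field and `g₁ = diag(1,1,ϖ)`, `[K₀ : K₀ ⊓ K₁] = |𝓀[K]| + 1 = [K₁ : K₀ ⊓ K₁]`
(the text of `stub_U0_iwahoriIndex_wild` after its binder prefix; U0 pays it by `exact`). [cite: Tits1979, §2.4, §2.7] [cite: Kottwitz1988, §2] -/
theorem index_inf_subgroupOf_eq_of_isRamifiedQuadraticDatum {K : Type} [Field K] [Valued K ℤᵐ⁰] [ValuativeRel K] [(Valued.v : Valuation K ℤᵐ⁰).Compatible] [Finite 𝓀[K]]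
    (σ : K →+* K) (ϖ : K) (d t : ℕ) (hD : IsRamifiedQuadraticDatum σ ϖ d t)
    (g₁ : GL (Fin 3) K) (hg₁ : (g₁ : Matrix (Fin 3) (Fin 3) K) = Matrix.diagonal ![(1 : K), 1, ϖ]) :
    (((glInt 3 K).subgroupOf (unitaryGroupOfForm σ ((StdForm.antidiagonal 3).over K)) ⊓
        ((glInt 3 K).map (MulAut.conj g₁).toMonoidHom).subgroupOf (unitaryGroupOfForm σ ((StdForm.antidiagonal 3).over K))).subgroupOf
          ((glInt 3 K).subgroupOf (unitaryGroupOfForm σ ((StdForm.antidiagonal 3).over K)))).index = Nat.card 𝓀[K] + 1 ∧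
      (((glInt 3 K).subgroupOf (unitaryGroupOfForm σ ((StdForm.antidiagonal 3).over K)) ⊓
        ((glInt 3 K).map (MulAut.conj g₁).toMonoidHom).subgroupOf (unitaryGroupOfForm σ ((StdForm.antidiagonal 3).over K))).subgroupOf
          (((glInt 3 K).map (MulAut.conj g₁).toMonoidHom).subgroupOf (unitaryGroupOfForm σ ((StdForm.antidiagonal 3).over K)))).index = Nat.card 𝓀[K] + 1 := by
  obtain ⟨hσ, hvσ, hϖ, heven, hd, h1d, h2t⟩ := hD
  exact index_inf_subgroupOf_eq_of_ramified_wild hσ hvσ hϖ heven hd h1d h2t g₁ hg₁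

end Literature.NumberTheory.Automorphic.UnitaryLatticeTree

end
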